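import Summits.ResolutionOfSingularities.ResolutionOfSingularities.Theorems.EquisingularLiftEquisingularLiftNatDirectionCentreSection
import Summits.ResolutionOfSingularities.ResolutionOfSingularities.Theorems.EquisingularLiftEquisingularLiftNatDirectionCentreComap
import Summits.ResolutionOfSingularities.ResolutionOfSingularities.Theorems.EquisingularLiftEquisingularLiftNatModelStep
import Literature.AlgebraicGeometry.Resolution.BlowupsExistence
import HarnessLib

/-!
# [OURS · L1 W4.5(b) · EL♮(3)] T-DIRLIFT, consumer side: THE DIRECTION ROUND at stage level — centre ∘ blow-up ∘ model square
# (`exists_subschemeIso_directionCentre` p555056 + `comap_directionCentre_eq_of_model` p551347 ∘ res-D-pv-029's `modelStep` p509016)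

Crux chain w45b (cell `res-hironaka`, slot W4.5(b)), working crux **EL♮** = stmt-ResolutionOfSingularities-20038, child **EL♮(3)** =
stmt-ResolutionOfSingularities-20148, route EquisingularLift, line `sections`; rungs DIR₀₀ (`stub_elnat_ratDirZeroPointResolution`, pv-051's
census brick (D) `dirStep_of_inv₁`) and the Čech rounds of the tower (res-D-pv-029 g8's `towerRoundCech_brick`). HONEST FRAMING: OURS; NOT a
statement of any manuscript; AI-written, weaker than expert review. No `sorry`; standard axioms. DEF-FREE.
`--supports stmt-ResolutionOfSingularities-20148 --as helper`.

WHAT. **`directionRoundStep`** — the analogue of `fatPointStep` (p547071) for a DIRECTION ROUND. In the binders of the K-kit's model step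
(a `Ch`-stage over the proper `q : P → Spec O`, model squares over `Spec θ`): the PREVIOUS stage `X₀` carries the in-carrier curve `C = V(I)`
(regular, integral, `O`-flat, off the generic points of `Y`), `τ₀ : X' → X₀` is the blowing up along `I` (the curve round already performed,
`τ₀` universally closed), `X'` is the current stage with model square `(F, j, t)` and `j ≫ τ₀ = υ ≫ j₀` over the downstairs blowing up
`υ : F → G₀` along `I·𝒪_{G₀}`; `𝒟` is a DIRECTION along `C` (`I·I ≤ 𝒟`, quasi-regular frames `(ℓ, m)` with `𝒟 = (ℓ) + (m²)` on `C`) whose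
downstairs direction centre is the reduced ideal of the closed set `Γ ⊆ T` (**hypothesis** `controlledTransform υ (I·𝒪_{G₀}) (𝒟·𝒪_{G₀}) 1 = 𝓘⟨Γ⟩`
— supplied by res-D-pv-051's DIRDICT (a) from `DirStepSec` + the P1VB lift, res-type-027), and `υ₂ : F₂ → F` is the downstairs blowing
up of `𝓘⟨Γ⟩`. THEN, with the centre `C' := controlledTransform τ₀ I 𝒟 1` (T-DIRLIFT D): `C' ≅ C` over `τ₀`, `C'·𝒪_F = 𝓘⟨Γ⟩`, `V(C')` regular,
integral and `O`-flat, and for a blowing up `τ : X'' → X'` along `C'` (tree `exists_isBlowup`) the model step gives the new `Ch`-stage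
`(X'', τ ≫ σ', closure τ⁻¹(S' ∖ supp C'))`, regular and locally Noetherian, with a model square `j₂ : F₂ → X''` over `Spec θ`,
`j₂ ≫ τ = υ₂ ≫ j`, and running set `j₂ '' closure υ₂⁻¹(T ∖ Γ)` — the `DirStep` bookkeeping `T ↦ closure υ₂⁻¹(T ∖ Γ)`.


References (index only): res-D-pv-029 `modelStep` (…NatModelStep p509016); T-DIRLIFT D3b/D4 (p555056 / p551347); …NatDirZeroDefs (`DirStep`).
-/

set_option linter.dupNamespace false -- mandated namespace `Summit.<Summit>.<Problem>` of this single-conjunct summit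
set_option linter.overlappingInstances false -- the binders carry `[IsDomain O] [IsDiscreteValuationRing O]`-style stacks downstream

noncomputable section

open CategoryTheory CategoryTheory.Limits AlgebraicGeometry TopologicalSpace Topology IsLocalRing
open Literature.AlgebraicGeometry.Resolution
open AlgebraicGeometry.Scheme.IdealSheafData

namespace Summit.ResolutionOfSingularities.ResolutionOfSingularities.Cruxes.EquisingularLiftNat.Sections

/-- **THE DIRECTION ROUND at stage level** (see the module docstring). [cite: StacksProject, Tags 0804, 0805]
[OURS · L1 W4.5b · T-DIRLIFT consumer side] -/
theorem directionRoundStep (O : Type) [CommRing O] [IsLocalRing O] (k : Type) [Field k] (θ : O →+* k) (hθ : Function.Surjective θ)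
    (P : Scheme.{0}) (q : P ⟶ Spec (.of O)) (Y : Set P)
    (Ch : ∀ X' : Scheme.{0}, (X' ⟶ P) → Set X' → Prop)
    (hStep : ∀ (X' X'' : Scheme.{0}) (σ' : X' ⟶ P) (S' : Set X') (C : X'.IdealSheafData) (τ : X'' ⟶ X'),
      Ch X' σ' S' → IsBlowup τ C → Scheme.IsRegular C.subscheme → Flat (C.subschemeι ≫ σ' ≫ q) →
      σ' '' (C.support : Set X') ⊆ {x : P | ¬ IsGenericPoint x Y} →
      (C.support : Set X') ∩ (σ' ≫ q) ⁻¹' {IsLocalRing.closedPoint O} ⊆ S' →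
      Ch X'' (τ ≫ σ') (closure (τ ⁻¹' (S' \ (C.support : Set X')))))
    -- the previous stage and its in-carrier curve `C = V(I)`
    (X₀ : Scheme.{0}) (σ₀ : X₀ ⟶ P) (I : X₀.IdealSheafData)
    (hIreg : Scheme.IsRegular I.subscheme) [AlgebraicGeometry.IsIntegral I.subscheme] (hIflat : Flat (I.subschemeι ≫ σ₀ ≫ q))
    (hIoff : σ₀ '' (I.support : Set X₀) ⊆ {x : P | ¬ IsGenericPoint x Y})
    -- the curve round `τ₀` and the current stage
    (X' : Scheme.{0}) (τ₀ : X' ⟶ X₀) (hτ₀ : IsBlowup τ₀ I) [UniversallyClosed τ₀]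
    (S' : Set X') (hCh : Ch X' (τ₀ ≫ σ₀) S') [IsLocallyNoetherian X'] (hreg : Scheme.IsRegular X')
    -- the model squares: previous special fibre `G₀`, current special fibre `F`, downstairs curve round `υ`
    (G₀ : Scheme.{0}) (j₀ : G₀ ⟶ X₀) (F : Scheme.{0}) (j : F ⟶ X') (t : F ⟶ Spec (.of k))
    (hsq : IsPullback j t ((τ₀ ≫ σ₀) ≫ q) (Spec.map (CommRingCat.ofHom θ)))
    (υ : F ⟶ G₀) (hcomm₀ : j ≫ τ₀ = υ ≫ j₀) (hυ : IsBlowup υ (I.comap j₀))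
    (T : Set F) (hTS : j '' T = S')
    -- the direction and its downstairs section `Γ`
    (𝒟 : X₀.IdealSheafData) (hI𝒟 : I * I ≤ 𝒟)
    (hdir : ∀ x ∈ I.support, ∃ c : Fin 2 → X₀.presheaf.stalk x, Ideal.span (Set.range c) = stalkIdeal I x ∧
      IsQuasiRegular c ∧ stalkIdeal 𝒟 x = Ideal.span {c 0} ⊔ Ideal.span {c 1 * c 1})
    (Γ : Set F) (hΓc : IsClosed Γ) (hΓT : Γ ⊆ T)
    (hΓ : controlledTransform υ (I.comap j₀) (𝒟.comap j₀) 1 = vanishingIdeal ⟨Γ, hΓc⟩)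
    -- the downstairs blow-up of the section
    (F₂ : Scheme.{0}) (υ₂ : F₂ ⟶ F) (hυ₂ : IsBlowup υ₂ (vanishingIdeal ⟨Γ, hΓc⟩)) :
    ∃ (X'' : Scheme.{0}) (τ : X'' ⟶ X') (j₂ : F₂ ⟶ X'') (t₂ : F₂ ⟶ Spec (.of k)),
      IsBlowup τ (controlledTransform τ₀ I 𝒟 1) ∧
      (controlledTransform τ₀ I 𝒟 1).comap j = vanishingIdeal ⟨Γ, hΓc⟩ ∧
      (∃ e : (controlledTransform τ₀ I 𝒟 1).subscheme ≅ I.subscheme,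
        e.hom ≫ I.subschemeι = (controlledTransform τ₀ I 𝒟 1).subschemeι ≫ τ₀) ∧
      Scheme.IsRegular (controlledTransform τ₀ I 𝒟 1).subscheme ∧
      AlgebraicGeometry.IsIntegral (controlledTransform τ₀ I 𝒟 1).subscheme ∧
      Flat ((controlledTransform τ₀ I 𝒟 1).subschemeι ≫ (τ₀ ≫ σ₀) ≫ q) ∧
      Ch X'' (τ ≫ τ₀ ≫ σ₀) (closure (τ ⁻¹' (S' \ ((controlledTransform τ₀ I 𝒟 1).support : Set X')))) ∧
      Scheme.IsRegular X'' ∧ IsLocallyNoetherian X'' ∧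
      IsPullback j₂ t₂ ((τ ≫ τ₀ ≫ σ₀) ≫ q) (Spec.map (CommRingCat.ofHom θ)) ∧ j₂ ≫ τ = υ₂ ≫ j ∧
      j₂ '' closure (υ₂ ⁻¹' (T \ Γ)) = closure (τ ⁻¹' (S' \ ((controlledTransform τ₀ I 𝒟 1).support : Set X'))) := by
  -- (1) T-DIRLIFT D3b: the centre is a section, `C' ≅ C` over `τ₀`
  obtain ⟨e, he⟩ := exists_subschemeIso_directionCentre hτ₀ 𝒟 hI𝒟 hdir
  -- (2) T-DIRLIFT D4: its special-fibre trace is the downstairs direction centre `= 𝓘⟨Γ⟩`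
  have hdir' : ∀ z ∈ (I.comap j₀).support, ∃ c : Fin 2 → X₀.presheaf.stalk (j₀ z),
      Ideal.span (Set.range c) = stalkIdeal I (j₀ z) ∧ stalkIdeal 𝒟 (j₀ z) = Ideal.span {c 0} ⊔ Ideal.span {c 1 * c 1} := by
    intro z hz
    have hx : j₀ z ∈ I.support := by
      have h : z ∈ ((I.comap j₀).support : Set G₀) := hz
      rw [Scheme.IdealSheafData.support_comap] at h
      exact h
    obtain ⟨c, hc, -, h𝒟⟩ := hdir _ hx
    exact ⟨c, hc, h𝒟⟩
  have hC'Γ : (controlledTransform τ₀ I 𝒟 1).comap j = vanishingIdeal ⟨Γ, hΓc⟩ := by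
    rw [comap_directionCentre_eq_of_model hτ₀ 𝒟 hI𝒟 hcomm₀ hυ hdir', hΓ]
  -- (3) transports along `e`
  have hC'reg : Scheme.IsRegular (controlledTransform τ₀ I 𝒟 1).subscheme := fun a => by
    -- (= `SectionAscent.TraceIdeal.isRegular_of_iso`, inlined to keep the import cone small)
    haveI := hIreg (e.hom a)
    exact IsRegularLocalRing.of_ringEquiv (asIso (e.hom.stalkMap a)).commRingCatIsoToRingEquiv
  have hC'int : AlgebraicGeometry.IsIntegral (controlledTransform τ₀ I 𝒟 1).subscheme := IsIntegral.of_isIso e.inv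
  have hC'flat : Flat ((controlledTransform τ₀ I 𝒟 1).subschemeι ≫ (τ₀ ≫ σ₀) ≫ q) := by
    have h : (controlledTransform τ₀ I 𝒟 1).subschemeι ≫ (τ₀ ≫ σ₀) ≫ q = e.hom ≫ (I.subschemeι ≫ σ₀ ≫ q) := by
      rw [← Category.assoc e.hom, he]; simp only [Category.assoc]
    rw [h]
    infer_instance
  have hoff : (τ₀ ≫ σ₀) '' ((controlledTransform τ₀ I 𝒟 1).support : Set X') ⊆ {x : P | ¬ IsGenericPoint x Y} := by
    rintro _ ⟨x', hx', rfl⟩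
    obtain ⟨z, rfl⟩ : x' ∈ Set.range (controlledTransform τ₀ I 𝒟 1).subschemeι := by
      rw [Scheme.IdealSheafData.range_subschemeι]; exact hx'
    apply hIoff
    refine ⟨τ₀ ((controlledTransform τ₀ I 𝒟 1).subschemeι z), ?_, (Scheme.Hom.comp_apply _ _ _).symm⟩
    have hpt : τ₀ ((controlledTransform τ₀ I 𝒟 1).subschemeι z) = I.subschemeι (e.hom z) := by
      rw [← Scheme.Hom.comp_apply, ← he, Scheme.Hom.comp_apply]
    rw [hpt]
    have h : I.subschemeι (e.hom z) ∈ (I.support : Set X₀) := by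
      rw [← Scheme.IdealSheafData.range_subschemeι]; exact ⟨_, rfl⟩
    exact h
  have hDT : ((vanishingIdeal ⟨Γ, hΓc⟩ : F.IdealSheafData).support : Set F) ⊆ T := by
    rw [Scheme.IdealSheafData.coe_support_vanishingIdeal]; exact hΓT
  -- (4) a blow-up of the stage along `C'` and the model step
  obtain ⟨X'', τ, hτ⟩ := exists_isBlowup X' (controlledTransform τ₀ I 𝒟 1)
  obtain ⟨hCh'', hreg'', hnoeth'', j₂, t₂, hsq₂, hcomm, himg⟩ :=
    modelStep O k θ hθ P q Y Ch hStep X' (τ₀ ≫ σ₀) S' hCh hreg F j t hsq T hTS (controlledTransform τ₀ I 𝒟 1)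
      (vanishingIdeal ⟨Γ, hΓc⟩) hC'Γ hC'reg hC'flat hoff hDT X'' τ hτ F₂ υ₂ hυ₂
  refine ⟨X'', τ, j₂, t₂, hτ, hC'Γ, ⟨e, he⟩, hC'reg, hC'int, hC'flat, ?_, hreg'', hnoeth'', ?_, hcomm, ?_⟩
  · simpa only [Category.assoc] using hCh''
  · simpa only [Category.assoc] using hsq₂
  · rw [← himg, Scheme.IdealSheafData.coe_support_vanishingIdeal]; rfl

end Summit.ResolutionOfSingularities.ResolutionOfSingularities.Cruxes.EquisingularLiftNat.Sections

end
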